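import Literature.Analysis.SpecialFunctions.LogFactorialRobbins
import Literature.NumberTheory.LFunctions.ChebyshevPsiExplicit
import Summits.Parity.BatemanHorn.Theorems.SoloInformedPolynomialGrowth
import Summits.Parity.BatemanHorn.Theorems.SoloInformedRootMertensConstant

/-!
# SoloInformedLocatedMangoldt — the located von Mangoldt layer of the values of `g` has a de la Vallée-Poussin secondary term

Solo unit `solo-Parity-informed` (ideation tier, informed mode), session 19; `PLAN.md` §27, CLAIMS C93.

**Theorem A** (`LocatedMangoldt.locatedVonMangoldt_isLittleO`). Let `g ∈ ℤ[X]` be irreducible of degree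
`d ≥ 1` with leading coefficient `a` and no root in `ℕ_{≥ 1}`, and let `0 < ε < 1`. With `γ_g` the Mertens
constant of `g` (`∑_{e ≤ N} Λ(e) ρ_g(e)/e - log N → -γ_g`, `SoloInformedRootMertensConstant`),

  `∑_{n ≤ x} ∑_{e ∣ g(n), e > x^{1-ε}} Λ(e) = (d - 1 + ε) x log x - (d - log |a| - γ_g) x + o(x)`.

For `g = X` this is de la Vallée-Poussin's `∑_{n ≤ x} Λ(n){x/n} = (1 - γ) x + o(x)` in disguise [Poussin1899;
MontgomeryVaughan2007, §2.2]. For `g = X² + 1` the prime layer is the object of the Chebyshev–Hooley method for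
`P⁺(n²+1)` [Hooley1976, Ch. 2, eqs. (35)–(41): `Σ_B = x log x + O(x)`; Merikoski2022, §2: `S(x) = X log x + O(x)`],
where only the `O(x)` form appears; the secondary constant `d - log |a| - γ_g` (for `X² + 1`: `2 - γ_{X²+1} ≈ 0.3731`)
is, as far as the unit could find, not in print.

## Proof (elementary given the tree)

`∑_{e ∣ m} Λ(e) = log m` splits the located sum as ALL − SMALL: ALL `= ∑_{n ≤ x} log |g(n)|
= d (x log x - x) + x log |a| + O(log x)` (`sum_log_eval_isLittleO`: pointwise `log |g(n)| = d log n + log |a| + O(1/n)`,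
Robbins' Stirling bounds); SMALL `= ∑_{e ≤ y} Λ(e) #{n ≤ x : e ∣ g(n)} = x ∑_{e ≤ y} Λ(e)ρ_g(e)/e + O(log y ∑_{e ≤ y} ρ_g(e))
= x (log y - γ_g) + o(x)` for `y = ⌊x^{1-ε}⌋` (Mertens along `g` WITH CONSTANT, `SoloInformedRootMertensConstant`).
-/

namespace Summit.Parity.BatemanHorn.Theorems

open Finset Filter ArithmeticFunction Asymptotics Polynomial
open scoped Topology
open Literature.NumberTheory.Sieve (polyRootCountMod)

namespace RootMertens

/-- The limit form: `∑_{e ≤ N} Λ(e) ρ_g(e)/e - log N → -γ_g`. -/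
theorem tendsto_of_abs_sub_le_div_log {u : ℕ → ℝ} {γ K : ℝ}
    (h : ∀ N : ℕ, 3 ≤ N → |u N - (Real.log N - γ)| ≤ K / Real.log N) :
    Tendsto (fun N : ℕ => u N - Real.log N) atTop (𝓝 (-γ)) := by
  have hK : Tendsto (fun N : ℕ => K / Real.log N) atTop (𝓝 0) :=
    tendsto_const_nhds.div_atTop (Real.tendsto_log_atTop.comp tendsto_natCast_atTop_atTop)
  rw [tendsto_iff_norm_sub_tendsto_zero]
  refine squeeze_zero' (Eventually.of_forall fun N => norm_nonneg _) ?_ hK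
  filter_upwards [eventually_ge_atTop 3] with N hN
  rw [Real.norm_eq_abs, show u N - Real.log N - -γ = u N - (Real.log N - γ) by ring]
  exact h N hN

end RootMertens

namespace LocatedMangoldt

/-! ### The values of `g`: `log |g(n)| = deg g · log n + log |a_d| + O(1/n)`, summed over `n ≤ x` -/

/-- `|g(n) - a_d n^d| ≤ B n^{d-1}` for `n ≥ 1`, with `B = ∑_{i<d} |g_i|`. -/
theorem abs_eval_sub_lead_le (g : ℤ[X]) {n : ℕ} (hn : 1 ≤ n) :
    |((g.eval (n : ℤ) : ℤ) : ℝ) - (g.leadingCoeff : ℝ) * (n : ℝ) ^ g.natDegree| ≤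
      (∑ i ∈ range g.natDegree, |(g.coeff i : ℝ)|) * (n : ℝ) ^ (g.natDegree - 1) := by
  have h : ((g.eval (n : ℤ) : ℤ) : ℝ) - (g.leadingCoeff : ℝ) * (n : ℝ) ^ g.natDegree =
      ∑ i ∈ range g.natDegree, (g.coeff i : ℝ) * (n : ℝ) ^ i := by
    rw [eval_eq_sum_range, sum_range_succ, coeff_natDegree]
    push_cast
    ring
  rw [h, sum_mul]
  refine (abs_sum_le_sum_abs _ _).trans (sum_le_sum fun i hi => ?_)
  rw [abs_mul, abs_pow, Nat.abs_cast]
  refine mul_le_mul_of_nonneg_left ?_ (abs_nonneg _)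
  exact pow_le_pow_right₀ (by exact_mod_cast hn) (by have := mem_range.mp hi; omega)

/-- `|log y| ≤ 2 |y - 1|` for `y ≥ 1/2`. -/
theorem abs_log_le_two_mul_abs_sub_one {y : ℝ} (hy : 1 / 2 ≤ y) : |Real.log y| ≤ 2 * |y - 1| := by
  have hy0 : 0 < y := by linarith
  have h1 : Real.log y ≤ y - 1 := Real.log_le_sub_one_of_pos hy0
  have h2 : 1 - y⁻¹ ≤ Real.log y := Real.one_sub_inv_le_log_of_pos hy0
  have h3 : 1 - y⁻¹ = (y - 1) / y := by field_simp
  rw [h3] at h2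
  rw [abs_le]
  rcases le_or_gt 1 y with hy1 | hy1
  · rw [abs_of_nonneg (by linarith : 0 ≤ y - 1)]
    have : 0 ≤ (y - 1) / y := div_nonneg (by linarith) hy0.le
    constructor <;> linarith
  · rw [abs_of_neg (by linarith : y - 1 < 0)]
    have : 2 * (y - 1) ≤ (y - 1) / y := by
      rw [le_div_iff₀ hy0]
      nlinarith
    constructor <;> linarith

/-- **`log |g(n)| = deg g · log n + log |a_d| + O(1/n)`**, uniformly in `n ≥ 1` (roots of `g`, if any, are
harmless: `log 0 = 0` and the finitely many small `n` are absorbed). -/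
theorem exists_abs_log_eval_sub_le_div {g : ℤ[X]} (hdeg : 0 < g.natDegree) :
    ∃ K : ℝ, 0 ≤ K ∧ ∀ n : ℕ, 1 ≤ n →
      |Real.log ((g.eval (n : ℤ)).natAbs : ℝ) - (g.natDegree * Real.log n + Real.log (|(g.leadingCoeff : ℝ)|))|
        ≤ K / n := by
  obtain ⟨B', hB'⟩ := exists_abs_log_natAbs_eval_sub_le hdeg
  have hB'0 : 0 ≤ B' := (abs_nonneg _).trans (hB' 1 le_rfl)
  set a : ℝ := (g.leadingCoeff : ℝ) with ha
  have hg : g ≠ 0 := fun h => by simp [h] at hdeg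
  have ha0 : a ≠ 0 := by
    rw [ha]
    exact_mod_cast leadingCoeff_ne_zero.mpr hg
  have ha0' : 0 < |a| := abs_pos.mpr ha0
  set B : ℝ := ∑ i ∈ range g.natDegree, |(g.coeff i : ℝ)| with hB
  have hB0 : 0 ≤ B := sum_nonneg fun i _ => abs_nonneg _
  set n₁ : ℕ := ⌈2 * B / |a|⌉₊ + 1 with hn₁
  set P : ℝ := B' + |Real.log (|a|)| with hP
  have hP0 : 0 ≤ P := by positivity
  refine ⟨2 * B / |a| + P * n₁, by positivity, fun n hn => ?_⟩
  have hn0 : (0 : ℝ) < n := by exact_mod_cast hn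
  rcases lt_or_ge n n₁ with hlt | hge
  · -- small `n`: the crude bound `≤ P ≤ P n₁ / n`
    have h2 : |Real.log ((g.eval (n : ℤ)).natAbs : ℝ) - (g.natDegree * Real.log n + Real.log (|a|))| ≤ P := by
      calc |Real.log ((g.eval (n : ℤ)).natAbs : ℝ) - (g.natDegree * Real.log n + Real.log (|a|))|
          = |(Real.log ((g.eval (n : ℤ)).natAbs : ℝ) - g.natDegree * Real.log n) - Real.log (|a|)| := by
            ring_nf
        _ ≤ |Real.log ((g.eval (n : ℤ)).natAbs : ℝ) - g.natDegree * Real.log n| + |Real.log (|a|)| :=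
            abs_sub _ _
        _ ≤ B' + |Real.log (|a|)| := add_le_add (hB' n hn) le_rfl
    rw [le_div_iff₀ hn0]
    have hnn : (n : ℝ) ≤ n₁ := by exact_mod_cast hlt.le
    have : 0 ≤ 2 * B / |a| := by positivity
    calc |Real.log ((g.eval (n : ℤ)).natAbs : ℝ) - (g.natDegree * Real.log n + Real.log (|a|))| * n
        ≤ P * n₁ := mul_le_mul h2 hnn hn0.le hP0
      _ ≤ 2 * B / |a| + P * n₁ := by linarith
  · -- large `n`: `|g(n)| = |a| n^d (1 + u)` with `|u| ≤ B/(|a| n) ≤ 1/2`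
    have hn₁le : 2 * B / |a| + 1 ≤ (n : ℝ) := by
      have h1 : 2 * B / |a| ≤ (⌈2 * B / |a|⌉₊ : ℝ) := Nat.le_ceil _
      have h2 : ((⌈2 * B / |a|⌉₊ + 1 : ℕ) : ℝ) ≤ n := by exact_mod_cast hge
      push_cast at h2
      linarith
    set A : ℝ := |a| * (n : ℝ) ^ g.natDegree with hA
    have hA0 : 0 < A := by positivity
    set V : ℝ := (((g.eval (n : ℤ)).natAbs : ℕ) : ℝ) with hV
    have hVabs : V = |((g.eval (n : ℤ) : ℤ) : ℝ)| := by
      rw [hV, Nat.cast_natAbs, Int.cast_abs]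
    have hVA : |V - A| ≤ B * (n : ℝ) ^ (g.natDegree - 1) := by
      rw [hVabs, hA]
      calc |(|((g.eval (n : ℤ) : ℤ) : ℝ)|) - |a| * (n : ℝ) ^ g.natDegree|
          = |(|((g.eval (n : ℤ) : ℤ) : ℝ)|) - (|a * (n : ℝ) ^ g.natDegree|)| := by
            rw [abs_mul, abs_of_nonneg (by positivity : (0 : ℝ) ≤ (n : ℝ) ^ g.natDegree)]
        _ ≤ |((g.eval (n : ℤ) : ℤ) : ℝ) - a * (n : ℝ) ^ g.natDegree| := abs_abs_sub_abs_le_abs_sub _ _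
        _ ≤ B * (n : ℝ) ^ (g.natDegree - 1) := abs_eval_sub_lead_le g hn
    have hpow : (n : ℝ) ^ g.natDegree = n * (n : ℝ) ^ (g.natDegree - 1) := by
      rw [← pow_succ', Nat.sub_add_cancel hdeg]
    have hratio : |V / A - 1| ≤ B / (|a| * n) := by
      rw [show V / A - 1 = (V - A) / A by field_simp, abs_div, abs_of_pos hA0,
        div_le_div_iff₀ hA0 (by positivity)]
      calc |V - A| * (|a| * n) ≤ B * (n : ℝ) ^ (g.natDegree - 1) * (|a| * n) :=
            mul_le_mul_of_nonneg_right hVA (by positivity)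
        _ = B * A := by rw [hA, hpow]; ring
    have hsmall : B / (|a| * n) ≤ 1 / 2 := by
      rw [div_le_div_iff₀ (by positivity) (by norm_num : (0 : ℝ) < 2)]
      have h1 : 2 * B / |a| * |a| = 2 * B := by field_simp
      nlinarith
    have hy : 1 / 2 ≤ V / A := by
      have := abs_le.mp (hratio.trans hsmall)
      linarith [this.1]
    have hV0 : 0 < V := lt_of_lt_of_le (by positivity) ((le_div_iff₀ hA0).mp hy)
    have hlogA : Real.log A = g.natDegree * Real.log n + Real.log (|a|) := by
      rw [hA, Real.log_mul ha0'.ne' (by positivity), Real.log_pow]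
      ring
    calc |Real.log V - (g.natDegree * Real.log n + Real.log (|a|))| = |Real.log (V / A)| := by
          rw [← hlogA, Real.log_div hV0.ne' hA0.ne']
      _ ≤ 2 * |V / A - 1| := abs_log_le_two_mul_abs_sub_one hy
      _ ≤ 2 * (B / (|a| * n)) := by gcongr
      _ = (2 * B / |a|) / n := by
          field_simp
      _ ≤ (2 * B / |a| + P * n₁) / n := by
          gcongr
          have : 0 ≤ P * n₁ := by positivity
          linarith

/-- **`∑_{n ≤ x} log |g(n)| = deg g · log x! + x log |a_d| + O(log x)`**. -/
theorem exists_abs_sum_log_eval_sub_le {g : ℤ[X]} (hdeg : 0 < g.natDegree) :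
    ∃ K : ℝ, 0 ≤ K ∧ ∀ x : ℕ, |∑ n ∈ Icc 1 x, Real.log ((g.eval (n : ℤ)).natAbs : ℝ)
        - (g.natDegree * Real.log (x.factorial : ℝ) + x * Real.log (|(g.leadingCoeff : ℝ)|))|
          ≤ K * (1 + Real.log x) := by
  obtain ⟨K, hK0, hK⟩ := exists_abs_log_eval_sub_le_div hdeg
  refine ⟨K, hK0, fun x => ?_⟩
  have hsum : ∑ n ∈ Icc 1 x, Real.log ((g.eval (n : ℤ)).natAbs : ℝ)
      - (g.natDegree * Real.log (x.factorial : ℝ) + x * Real.log (|(g.leadingCoeff : ℝ)|))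
      = ∑ n ∈ Icc 1 x, (Real.log ((g.eval (n : ℤ)).natAbs : ℝ)
          - (g.natDegree * Real.log n + Real.log (|(g.leadingCoeff : ℝ)|))) := by
    rw [sum_sub_distrib, sum_add_distrib, ← mul_sum,
      ← Literature.NumberTheory.LFunctions.ChebyshevExplicit.log_factorial_eq_sum_log, sum_const, Nat.card_Icc,
      Nat.add_sub_cancel, nsmul_eq_mul]
  rw [hsum]
  calc |∑ n ∈ Icc 1 x, (Real.log ((g.eval (n : ℤ)).natAbs : ℝ)
          - (g.natDegree * Real.log n + Real.log (|(g.leadingCoeff : ℝ)|)))|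
      ≤ ∑ n ∈ Icc 1 x, |Real.log ((g.eval (n : ℤ)).natAbs : ℝ)
          - (g.natDegree * Real.log n + Real.log (|(g.leadingCoeff : ℝ)|))| := abs_sum_le_sum_abs _ _
    _ ≤ ∑ n ∈ Icc 1 x, K / n := sum_le_sum fun n hn => hK n (mem_Icc.mp hn).1
    _ = K * (harmonic x : ℝ) := by
        rw [harmonic_eq_sum_Icc, mul_comm]
        push_cast
        rw [sum_mul]
        exact sum_congr rfl fun n _ => by rw [div_eq_inv_mul]
    _ ≤ K * (1 + Real.log x) := mul_le_mul_of_nonneg_left (harmonic_le_one_add_log x) hK0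

/-- `1 + log x = o(x)` along `ℕ`. -/
theorem one_add_log_isLittleO : (fun x : ℕ => 1 + Real.log x) =o[atTop] fun x : ℕ => (x : ℝ) := by
  have hlog : (fun x : ℕ => Real.log x) =o[atTop] fun x : ℕ => (x : ℝ) :=
    Real.isLittleO_log_id_atTop.comp_tendsto tendsto_natCast_atTop_atTop
  have h1 : (fun _ : ℕ => (1 : ℝ)) =o[atTop] fun x : ℕ => (x : ℝ) := by
    refine isLittleO_const_left.mpr (Or.inr ?_)
    exact tendsto_norm_atTop_atTop.comp tendsto_natCast_atTop_atTop
  exact h1.add hlog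

/-- `log x! - (x log x - x) = o(x)` (Robbins/Stirling: it is `½ log(2πx) + O(1/x)`). -/
theorem log_factorial_sub_isLittleO :
    (fun x : ℕ => Real.log (x.factorial : ℝ) - ((x : ℝ) * Real.log x - x)) =o[atTop] fun x : ℕ => (x : ℝ) := by
  refine IsBigO.trans_isLittleO ?_ one_add_log_isLittleO
  refine IsBigO.of_bound 5 ?_
  filter_upwards [eventually_ge_atTop 1] with x hx
  have hx0 : x ≠ 0 := by omega
  obtain ⟨h1, h2⟩ := Literature.Analysis.SpecialFunctions.abs_log_factorial_sub_stirling_le hx0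
  have hxR : (1 : ℝ) ≤ x := by exact_mod_cast hx
  have hlx : 0 ≤ Real.log x := Real.log_nonneg hxR
  have hl2pi : Real.log (2 * Real.pi * x) = Real.log (2 * Real.pi) + Real.log x :=
    Real.log_mul (by positivity) (by positivity)
  have hl2pi' : Real.log (2 * Real.pi) ≤ 2 * Real.pi - 1 := Real.log_le_sub_one_of_pos (by positivity)
  have hl2pi0 : 0 ≤ Real.log (2 * Real.pi) := Real.log_nonneg (by linarith [Real.pi_gt_three])
  have hpi : Real.pi ≤ 4 := Real.pi_le_four
  have h3 : 1 / (12 * (x : ℝ)) ≤ 1 := div_le_one_of_le₀ (by linarith) (by positivity)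
  rw [Real.norm_eq_abs, Real.norm_eq_abs, abs_of_nonneg (by positivity : (0 : ℝ) ≤ 1 + Real.log x), abs_le]
  rw [hl2pi] at h1 h2
  constructor <;> nlinarith

/-- **`E₁`**: `∑_{n ≤ x} log |g(n)| - (deg g · (x log x - x) + x log |a_d|) = o(x)`. -/
theorem sum_log_eval_isLittleO {g : ℤ[X]} (hdeg : 0 < g.natDegree) :
    (fun x : ℕ => ∑ n ∈ Icc 1 x, Real.log ((g.eval (n : ℤ)).natAbs : ℝ)
        - (g.natDegree * ((x : ℝ) * Real.log x - x) + x * Real.log (|(g.leadingCoeff : ℝ)|)))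
      =o[atTop] fun x : ℕ => (x : ℝ) := by
  obtain ⟨K, hK0, hK⟩ := exists_abs_sum_log_eval_sub_le hdeg
  have h1 : (fun x : ℕ => ∑ n ∈ Icc 1 x, Real.log ((g.eval (n : ℤ)).natAbs : ℝ)
      - (g.natDegree * Real.log (x.factorial : ℝ) + x * Real.log (|(g.leadingCoeff : ℝ)|)))
        =o[atTop] fun x : ℕ => (x : ℝ) := by
    refine IsBigO.trans_isLittleO ?_ one_add_log_isLittleO
    refine IsBigO.of_bound K (Eventually.of_forall fun x => ?_)
    rw [Real.norm_eq_abs, Real.norm_eq_abs,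
      abs_of_nonneg (add_nonneg zero_le_one (Real.log_natCast_nonneg x))]
    exact hK x
  have h2 := log_factorial_sub_isLittleO.const_mul_left (g.natDegree : ℝ)
  exact (h1.add h2).congr_left fun x => by ring

/-! ### The located von Mangoldt sum -/

/-- Exchange of summation over the small divisors: for `g` without roots in `[1, x]`,
`∑_{n ≤ x} ∑_{e ∣ |g(n)|, e ≤ D} Λ(e) = ∑_{e ≤ D} Λ(e) · #{n ≤ x : e ∣ g(n)}`. -/
theorem sum_smallDivisors_eq (g : ℤ[X]) (hg0 : ∀ n : ℕ, 1 ≤ n → g.eval (n : ℤ) ≠ 0) (x D : ℕ) :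
    ∑ n ∈ Icc 1 x, ∑ e ∈ ((g.eval (n : ℤ)).natAbs.divisors).filter (fun e => e ≤ D), Λ e =
      ∑ e ∈ Icc 1 D, Λ e * (#((Icc 1 x).filter fun n : ℕ => (e : ℤ) ∣ g.eval (n : ℤ)) : ℝ) := by
  calc ∑ n ∈ Icc 1 x, ∑ e ∈ ((g.eval (n : ℤ)).natAbs.divisors).filter (fun e => e ≤ D), Λ e
      = ∑ n ∈ Icc 1 x, ∑ e ∈ (Icc 1 D).filter (fun e => e ∣ (g.eval (n : ℤ)).natAbs), Λ e := by
        refine sum_congr rfl fun n hn => ?_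
        rw [divisors_filter_le_eq_Icc_filter (Int.natAbs_ne_zero.mpr (hg0 n (mem_Icc.mp hn).1))]
    _ = ∑ n ∈ Icc 1 x, ∑ e ∈ Icc 1 D, (if (e : ℤ) ∣ g.eval (n : ℤ) then Λ e else 0) := by
        refine sum_congr rfl fun n _ => ?_
        rw [sum_filter]
        refine sum_congr rfl fun e _ => ?_
        simp only [Int.natCast_dvd]
    _ = ∑ e ∈ Icc 1 D, ∑ n ∈ Icc 1 x, (if (e : ℤ) ∣ g.eval (n : ℤ) then Λ e else 0) := sum_comm
    _ = ∑ e ∈ Icc 1 D, Λ e * (#((Icc 1 x).filter fun n : ℕ => (e : ℤ) ∣ g.eval (n : ℤ)) : ℝ) := by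
        refine sum_congr rfl fun e _ => ?_
        rw [← sum_filter, sum_const, nsmul_eq_mul, mul_comm]

/-- `∑_{e ∣ N, e > D} Λ(e) = log N - ∑_{e ∣ N, e ≤ D} Λ(e)`. -/
theorem sum_largeDivisors_vonMangoldt_eq (N D : ℕ) :
    ∑ e ∈ N.divisors.filter (fun e => D < e), Λ e =
      Real.log N - ∑ e ∈ N.divisors.filter (fun e => e ≤ D), Λ e := by
  rw [← vonMangoldt_sum (n := N), ← sum_filter_add_sum_filter_not N.divisors (fun e => e ≤ D)]
  simp only [not_le]
  ring

/-- **Theorem A (the located von Mangoldt layer has a de la Vallée-Poussin secondary term).**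
For `g ∈ ℤ[X]` irreducible of degree `d ≥ 1` without natural roots, leading coefficient `a`, and `0 < ε < 1`:
`∑_{n ≤ x} ∑_{e ∣ g(n), e > x^{1-ε}} Λ(e) = (d - 1 + ε) x log x - (d - log |a| - γ_g) x + o(x)`,
where `γ_g` is the Mertens constant of `g`: `∑_{e ≤ N} Λ(e) ρ_g(e)/e - log N → -γ_g`.
(For `g = X` this is de la Vallée-Poussin's `∑_{n ≤ x} Λ(n) {x/n} = (1 - γ) x + o(x)` in disguise.) -/
theorem locatedVonMangoldt_isLittleO {g : ℤ[X]} (hirr : Irreducible g) (hdeg : 0 < g.natDegree)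
    (hg0 : ∀ n : ℕ, 1 ≤ n → g.eval (n : ℤ) ≠ 0) {ε : ℝ} (hε : 0 < ε) (hε1 : ε < 1) :
    ∃ γ : ℝ,
      Tendsto (fun N : ℕ => ∑ e ∈ Icc 1 N, Λ e * (polyRootCountMod ![g] e : ℝ) / e - Real.log N)
        atTop (𝓝 (-γ)) ∧
      (fun x : ℕ => ∑ n ∈ Icc 1 x, ∑ e ∈ ((g.eval (n : ℤ)).natAbs.divisors).filter
            (fun e => ⌊(x : ℝ) ^ (1 - ε)⌋₊ < e), Λ e
          - ((g.natDegree - 1 + ε) * x * Real.log x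
              - (g.natDegree - Real.log (|(g.leadingCoeff : ℝ)|) - γ) * x))
        =o[atTop] fun x : ℕ => (x : ℝ) := by
  obtain ⟨γ, K, hγ⟩ := RootMertens.exists_abs_sum_vonMangoldt_rootCount_div_sub_le hirr hdeg
  have hlim := RootMertens.tendsto_of_abs_sub_le_div_log hγ
  refine ⟨γ, hlim, ?_⟩
  obtain ⟨C₁, hC₁0, hC₁⟩ := Literature.NumberTheory.Sieve.exists_sum_rootCount_le hirr hdeg
  set ρ : ℕ → ℝ := fun e => (polyRootCountMod ![g] e : ℝ) with hρ
  set D : ℕ → ℕ := fun x => ⌊(x : ℝ) ^ (1 - ε)⌋₊ with hD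
  set Lsum : ℕ → ℝ := fun x => ∑ n ∈ Icc 1 x, Real.log ((g.eval (n : ℤ)).natAbs : ℝ) with hLsum
  set Small : ℕ → ℝ := fun x =>
    ∑ e ∈ Icc 1 (D x), Λ e * (#((Icc 1 x).filter fun n : ℕ => (e : ℤ) ∣ g.eval (n : ℤ)) : ℝ) with hSmall
  set Mert : ℕ → ℝ := fun x => ∑ e ∈ Icc 1 (D x), Λ e * ρ e / e with hMert
  -- `D → ∞`
  have hDt : Tendsto D atTop atTop :=
    tendsto_nat_floor_atTop.comp ((tendsto_rpow_atTop (by linarith)).comp tendsto_natCast_atTop_atTop)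
  have hDR : Tendsto (fun x => ((D x : ℕ) : ℝ)) atTop atTop := tendsto_natCast_atTop_atTop.comp hDt
  -- (0) located = all - small
  have h0 : ∀ x : ℕ, ∑ n ∈ Icc 1 x, ∑ e ∈ ((g.eval (n : ℤ)).natAbs.divisors).filter
      (fun e => D x < e), Λ e = Lsum x - Small x := by
    intro x
    simp only [hLsum, hSmall]
    rw [← sum_smallDivisors_eq g hg0 x (D x), ← sum_sub_distrib]
    exact sum_congr rfl fun n _ => sum_largeDivisors_vonMangoldt_eq _ _
  -- (1) `E₁ = o(x)`
  have hE1 := sum_log_eval_isLittleO hdeg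
  -- (2) `E₂ := Small - x · Mert = O(log D · D) = o(x)`
  have hE2 : (fun x : ℕ => Small x - x * Mert x) =o[atTop] fun x : ℕ => (x : ℝ) := by
    refine IsBigO.trans_isLittleO ?_ (rpowCut_mul_log_isLittleO hε hε1)
    refine IsBigO.of_bound C₁ ?_
    filter_upwards [hDt.eventually_ge_atTop 2] with x hx
    have hDx : (2 : ℝ) ≤ (D x : ℝ) := by exact_mod_cast hx
    have hlogD : 0 ≤ Real.log (D x : ℝ) := Real.log_nonneg (by linarith)
    rw [Real.norm_eq_abs, Real.norm_eq_abs, abs_of_nonneg (mul_nonneg hlogD (Nat.cast_nonneg _))]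
    have hdiff : Small x - x * Mert x = ∑ e ∈ Icc 1 (D x),
        Λ e * ((#((Icc 1 x).filter fun n : ℕ => (e : ℤ) ∣ g.eval (n : ℤ)) : ℝ) - (x : ℝ) * ρ e / e) := by
      simp only [hSmall, hMert, mul_sum, ← sum_sub_distrib]
      exact sum_congr rfl fun e _ => by ring
    rw [hdiff]
    calc |∑ e ∈ Icc 1 (D x), Λ e * ((#((Icc 1 x).filter fun n : ℕ => (e : ℤ) ∣ g.eval (n : ℤ)) : ℝ)
            - (x : ℝ) * ρ e / e)|
        ≤ ∑ e ∈ Icc 1 (D x), |Λ e * ((#((Icc 1 x).filter fun n : ℕ => (e : ℤ) ∣ g.eval (n : ℤ)) : ℝ)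
            - (x : ℝ) * ρ e / e)| := abs_sum_le_sum_abs _ _
      _ ≤ ∑ e ∈ Icc 1 (D x), Real.log (D x : ℝ) * ρ e := by
          refine sum_le_sum fun e he => ?_
          have he1 : 1 ≤ e := (mem_Icc.mp he).1
          have heD : (e : ℝ) ≤ D x := by exact_mod_cast (mem_Icc.mp he).2
          rw [abs_mul, abs_of_nonneg vonMangoldt_nonneg]
          refine mul_le_mul (vonMangoldt_le_log.trans (Real.log_le_log (by exact_mod_cast he1) heD))
            (abs_card_filter_dvd_eval_sub_le g he1 x) (abs_nonneg _) hlogD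
      _ = Real.log (D x : ℝ) * ∑ e ∈ Icc 1 (D x), ρ e := by rw [mul_sum]
      _ ≤ Real.log (D x : ℝ) * (C₁ * (D x : ℝ)) := by
          refine mul_le_mul_of_nonneg_left ?_ hlogD
          have := hC₁ (D x : ℝ) hDx
          rwa [Nat.floor_natCast] at this
      _ = C₁ * (Real.log (D x : ℝ) * (D x : ℝ)) := by ring
  -- (3) `E₃ := x (Mert - (log D - γ)) = o(x)`
  have hr3 : Tendsto (fun x : ℕ => Mert x - (Real.log (D x : ℝ) - γ)) atTop (𝓝 0) := by
    have h := hlim.comp hDt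
    have h' : Tendsto (fun x : ℕ => (Mert x - Real.log (D x : ℝ)) + γ) atTop (𝓝 (-γ + γ)) :=
      h.add_const γ
    rw [neg_add_cancel] at h'
    refine h'.congr fun x => ?_
    simp only [hMert, hρ]
    ring
  have hE3 : (fun x : ℕ => (x : ℝ) * (Mert x - (Real.log (D x : ℝ) - γ))) =o[atTop] fun x : ℕ => (x : ℝ) := by
    have := (isBigO_refl (fun x : ℕ => (x : ℝ)) atTop).mul_isLittleO (isLittleO_one_iff ℝ |>.mpr hr3)
    exact this.congr_right fun x => mul_one _
  -- (4) `E₄ := x (log D - (1-ε) log x) = o(x)`: `|log D - (1-ε) log x| ≤ 1/D`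
  have hr4 : Tendsto (fun x : ℕ => Real.log (D x : ℝ) - (1 - ε) * Real.log x) atTop (𝓝 0) := by
    have hinv : Tendsto (fun x : ℕ => ((D x : ℕ) : ℝ)⁻¹) atTop (𝓝 0) := hDR.inv_tendsto_atTop
    refine squeeze_zero_norm' ?_ hinv
    filter_upwards [eventually_ge_atTop 1, hDt.eventually_ge_atTop 1] with x hx hDx1
    have hx0 : (0 : ℝ) < x := by exact_mod_cast hx
    have hD0 : (0 : ℝ) < (D x : ℝ) := by exact_mod_cast hDx1
    have ht0 : 0 < (x : ℝ) ^ (1 - ε) := Real.rpow_pos_of_pos hx0 _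
    have hDle : (D x : ℝ) ≤ (x : ℝ) ^ (1 - ε) := Nat.floor_le ht0.le
    have hDlt : (x : ℝ) ^ (1 - ε) < (D x : ℝ) + 1 := Nat.lt_floor_add_one _
    have hlogt : Real.log ((x : ℝ) ^ (1 - ε)) = (1 - ε) * Real.log x := Real.log_rpow hx0 _
    have h1 : Real.log (D x : ℝ) ≤ (1 - ε) * Real.log x := by
      rw [← hlogt]
      exact Real.log_le_log hD0 hDle
    have h2 : (1 - ε) * Real.log x - Real.log (D x : ℝ) ≤ ((D x : ℕ) : ℝ)⁻¹ := by
      rw [← hlogt, ← Real.log_div ht0.ne' hD0.ne']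
      have := Real.log_le_sub_one_of_pos (div_pos ht0 hD0)
      have h3 : (x : ℝ) ^ (1 - ε) / (D x : ℝ) - 1 ≤ ((D x : ℕ) : ℝ)⁻¹ := by
        rw [div_sub_one hD0.ne', div_le_iff₀ hD0, inv_mul_cancel₀ hD0.ne']
        linarith
      linarith
    rw [Real.norm_eq_abs, abs_le]
    constructor <;> linarith [inv_nonneg.mpr hD0.le]
  have hE4 : (fun x : ℕ => (x : ℝ) * (Real.log (D x : ℝ) - (1 - ε) * Real.log x)) =o[atTop]
      fun x : ℕ => (x : ℝ) := by
    have := (isBigO_refl (fun x : ℕ => (x : ℝ)) atTop).mul_isLittleO (isLittleO_one_iff ℝ |>.mpr hr4)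
    exact this.congr_right fun x => mul_one _
  -- assemble: `located - main = E₁ - E₂ - E₃ - E₄`
  refine (((hE1.sub hE2).sub hE3).sub hE4).congr_left fun x => ?_
  rw [h0 x]
  simp only [hLsum, hSmall, hMert]
  ring

end LocatedMangoldt

end Summit.Parity.BatemanHorn.Theorems
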